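import Mathlib
import HarnessLib
import Summits.Ventures.LatticeQCDFlow.Exactness.NCMCGeneralSpaceMarkovErgodic

/-!
# Irreducible or Doeblin-minorised level samplers make the engine's restart chain ergodic: `ΔF̂_n → ΔF` almost surely for correlated equilibrium starts

HONEST FRAMING: exact (Metropolis-corrected) sampling algorithms for lattice gauge theory;
figures of merit are autocorrelation/cost numbers at stated couplings and volumes; no
continuum-physics claim.

Venture `LatticeQCDFlow` (cell pub-lqcd), topic `Exactness`; FANOUT row 13 (`eng-snf`, GEN-16).
NEW WORK of the cell, not a published result; no definition is introduced; nothing is cited as a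
fact.  Continuation of `NCMCGeneralSpaceMarkovErgodic.lean` (the criterion `ergodic_shift_chain`: a
stationary Markov chain whose kernel has no non-trivial almost invariant set is shift-ergodic):
two checkable sufficient conditions and the engine corollary.

## Content (`κ` Markov on `S`, `π` an invariant probability law)

* `exists_of_ae_imp`, `ae_kernel_null_of_invariant`, `ae_pow_apply_eq_zero` — bookkeeping: an
  invariant law pushes its null sets forward through the kernel, so "`κ(z, B) = 0` for a.e. `z ∉ B`"
  iterates to every power `κⁿ`.
* **`ae_invariant_trivial_of_isIrreducible`**, **`ergodic_shift_chain_of_isIrreducible`** —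
  Mathlib's `Kernel.IsIrreducible π κ` (every `π`-positive set is reached from every state in
  finitely many steps with positive probability; Meyn–Tweedie `φ`-irreducibility with `φ = π`)
  gives the criterion, hence ergodicity of `P_{π,κ}`.
* **`ae_invariant_trivial_of_minorized`**, **`ergodic_shift_chain_of_minorized`** — a one-step
  Doeblin minorisation `ε ν ≤ κ(z, ·)` for all `z` (`ε ≠ 0`, `ν` ANY probability law; row 8's
  certificates `Scoring/Doeblin*.lean` use `ν = π`) gives the criterion, hence ergodicity.
* **`minorized_comp_comap`** — a minorisation of the level sampler `K` by `ε ν` passes to the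
  restart kernel `(κF ∘ₖ K).comap s` of `NCMCGeneralSpaceMarkovRun.lean`, with minorising law
  `κF ∘ₘ ν`; hence **`CrooksPair.ergodic_restartChain_of_minorized`** and
  **`CrooksPair.tendsto_jarzynskiEstimate_ae_restartChain_of_minorized`** — for every Crooks pair
  and every `ν₀`-invariant level sampler obeying a Doeblin minorisation, the Jarzynski estimate
  along the equilibrium restart chain of forward records converges to `ΔF` ALMOST SURELY, with no
  independence between the evolutions (the `hErg` hypothesis of `NCMCGeneralSpaceMarkovRun` is
  discharged).

NOT CLAIMED: a minorisation constant for any concrete sampler (row 8 types `ε = e^{−2δ}` for the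
exact flow sampler; heat-bath / overrelaxation sweeps are not certified here); rates or error bars.
-/

namespace Summit.Ventures.LatticeQCDFlow.Exactness.GeneralNCMC

open MeasureTheory ProbabilityTheory Set Filter Finset Preorder
open scoped ENNReal Topology

variable {S : Type*} [MeasurableSpace S] (κ : Kernel S S) [IsMarkovKernel κ]
variable {π : Measure S}

/-- From an almost-everywhere implication on a non-null set, a witness. -/
theorem exists_of_ae_imp {p : S → Prop} {B : Set S}
    (h : ∀ᵐ z ∂π, z ∈ B → p z) (hB : π B ≠ 0) : ∃ z ∈ B, p z := by
  by_contra hne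
  have hne' : ∀ z ∈ B, ¬ p z := fun z hzB hp => hne ⟨z, hzB, hp⟩
  have : ∀ᵐ z ∂π, z ∉ B := h.mono fun z hz hzB => hne' z hzB (hz hzB)
  exact hB (measure_eq_zero_iff_ae_notMem.2 this)

omit [IsMarkovKernel κ] in
/-- **An invariant law pushes its null sets forward**: `π N = 0 ⇒ κ(z, N) = 0` for `π`-a.e. `z`. -/
theorem ae_kernel_null_of_invariant (hπ : Kernel.Invariant κ π) {N : Set S} (hN : MeasurableSet N)
    (h0 : π N = 0) : ∀ᵐ z ∂π, κ z N = 0 := by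
  have h1 : ∫⁻ z, κ z N ∂π = 0 := by
    rw [← Measure.bind_apply hN (Kernel.aemeasurable _), hπ.def, h0]
  exact (lintegral_eq_zero_iff (Kernel.measurable_coe κ hN)).1 h1

omit [IsMarkovKernel κ] in
/-- If `κ(z, B) = 0` for `π`-a.e. `z ∉ B`, then `κⁿ(z, B) = 0` for `π`-a.e. `z ∉ B`, for every `n`. -/
theorem ae_pow_apply_eq_zero (hπ : Kernel.Invariant κ π) {B : Set S} (hB : MeasurableSet B)
    (hin : ∀ᵐ z ∂π, z ∉ B → κ z B = 0) : ∀ n : ℕ, ∀ᵐ z ∂π, z ∉ B → (κ ^ n) z B = 0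
  | 0 => Eventually.of_forall fun z hz => by
      rw [pow_zero]
      change Kernel.id z B = 0
      rw [Kernel.id_apply, Measure.dirac_apply' _ hB, Set.indicator_of_notMem hz]
  | n + 1 => by
      have IH := ae_pow_apply_eq_zero hπ hB hin n
      have hNm : MeasurableSet {y : S | y ∉ B ∧ (κ ^ n) y B ≠ 0} :=
        hB.compl.inter ((Kernel.measurable_coe (κ ^ n) hB) (measurableSet_singleton 0)).compl
      have hN0 : π {y : S | y ∉ B ∧ (κ ^ n) y B ≠ 0} = 0 := by
        rw [measure_eq_zero_iff_ae_notMem]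
        filter_upwards [IH] with y hy
        rintro ⟨hyB, hne⟩
        exact hne (hy hyB)
      have hKN := ae_kernel_null_of_invariant κ hπ hNm hN0
      filter_upwards [hin, hKN] with z hz hzN hzB
      rw [show n + 1 = 1 + n from Nat.add_comm n 1, Kernel.pow_add_apply_eq_lintegral κ 1 n z hB,
        pow_one]
      have h1 : ∀ᵐ b ∂(κ z), b ∉ B := measure_eq_zero_iff_ae_notMem.1 (hz hzB)
      have h2 : ∀ᵐ b ∂(κ z), b ∉ {y : S | y ∉ B ∧ (κ ^ n) y B ≠ 0} :=
        measure_eq_zero_iff_ae_notMem.1 hzN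
      have h3 : (fun b => (κ ^ n) b B) =ᵐ[κ z] 0 := by
        filter_upwards [h1, h2] with b hb1 hb2
        by_contra hne
        exact hb2 ⟨hb1, hne⟩
      rw [lintegral_congr_ae h3]
      exact lintegral_zero

/-! ## Irreducibility ⇒ the criterion ⇒ ergodic -/

omit [IsMarkovKernel κ] in
/-- **A `π`-irreducible kernel has no non-trivial almost invariant set**: if `κ(z, B) = 0` for
`π`-a.e. `z ∉ B` then `π B ∈ {0, 1}` (only the inward half of almost-invariance is needed). -/
theorem ae_invariant_trivial_of_isIrreducible [IsProbabilityMeasure π] (hπ : Kernel.Invariant κ π)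
    [hI : Kernel.IsIrreducible π κ] (B : Set S) (hB : MeasurableSet B)
    (hin : ∀ᵐ z ∂π, z ∉ B → κ z B = 0) : π B = 0 ∨ π B = 1 := by
  by_cases hB0 : π B = 0
  · exact Or.inl hB0
  right
  by_contra hB1
  have hBc : π Bᶜ ≠ 0 := fun h => hB1 ((prob_compl_eq_zero_iff hB).1 h)
  have hall : ∀ᵐ z ∂π, z ∈ Bᶜ → ∀ n : ℕ, (κ ^ n) z B = 0 := by
    have := ae_all_iff.2 (ae_pow_apply_eq_zero κ hπ hB hin)
    filter_upwards [this] with z hz hzB n using hz n hzB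
  obtain ⟨a, -, ha⟩ := exists_of_ae_imp hall hBc
  obtain ⟨n, hn⟩ := hI.irreducible hB (pos_iff_ne_zero.2 hB0) a
  exact hn.ne' (ha n)

/-- **A stationary `π`-IRREDUCIBLE Markov chain is ergodic.** -/
theorem ergodic_shift_chain_of_isIrreducible [IsProbabilityMeasure π] (hπ : Kernel.Invariant κ π)
    [Kernel.IsIrreducible π κ] :
    Ergodic (fun (x : ℕ → S) (k : ℕ) => x (k + 1))
      (Kernel.trajMeasure (X := fun _ : ℕ => S) π
        (fun n : ℕ => κ.comap (fun h : (j : ↥(Finset.Iic n)) → S => h ⟨n, Finset.mem_Iic.2 le_rfl⟩)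
          (measurable_pi_apply _))) :=
  ergodic_shift_chain κ hπ fun B hB _ hin => ae_invariant_trivial_of_isIrreducible κ hπ B hB hin

/-! ## A Doeblin minorisation ⇒ the criterion ⇒ ergodic -/

omit [IsMarkovKernel κ] in
/-- **A Doeblin-minorised kernel has no non-trivial almost invariant set**: if `ε ν ≤ κ(z, ·)` for
every `z` with `ε ≠ 0` and `ν` a probability law, every almost invariant `B` has `π B ∈ {0, 1}`. -/
theorem ae_invariant_trivial_of_minorized [IsProbabilityMeasure π] {ε : ℝ≥0∞} (hε : ε ≠ 0)
    {ν : Measure S} [IsProbabilityMeasure ν] (hmin : ∀ z t, MeasurableSet t → ε * ν t ≤ κ z t)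
    (B : Set S) (hB : MeasurableSet B) (hout : ∀ᵐ z ∂π, z ∈ B → κ z Bᶜ = 0)
    (hin : ∀ᵐ z ∂π, z ∉ B → κ z B = 0) : π B = 0 ∨ π B = 1 := by
  by_cases hB0 : π B = 0
  · exact Or.inl hB0
  by_cases hBc : π Bᶜ = 0
  · exact Or.inr ((prob_compl_eq_zero_iff hB).1 hBc)
  exfalso
  have hin' : ∀ᵐ z ∂π, z ∈ Bᶜ → κ z B = 0 := hin
  obtain ⟨z, -, hz⟩ := exists_of_ae_imp hin' hBc
  obtain ⟨w, -, hw⟩ := exists_of_ae_imp hout hB0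
  have h1 : ν B = 0 := by
    have hle := hmin z B hB
    rw [hz] at hle
    exact (mul_eq_zero.1 (le_antisymm hle bot_le)).resolve_left hε
  have h2 : ν Bᶜ = 0 := by
    have hle := hmin w Bᶜ hB.compl
    rw [hw] at hle
    exact (mul_eq_zero.1 (le_antisymm hle bot_le)).resolve_left hε
  have huniv : ν univ = 0 := by
    rw [← Set.union_compl_self B, measure_union disjoint_compl_right hB.compl, h1, h2, add_zero]
  exact one_ne_zero (measure_univ.symm.trans huniv)

/-- **A stationary Markov chain with a Doeblin minorisation is ergodic.** -/
theorem ergodic_shift_chain_of_minorized [IsProbabilityMeasure π] (hπ : Kernel.Invariant κ π)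
    {ε : ℝ≥0∞} (hε : ε ≠ 0) {ν : Measure S} [IsProbabilityMeasure ν]
    (hmin : ∀ z t, MeasurableSet t → ε * ν t ≤ κ z t) :
    Ergodic (fun (x : ℕ → S) (k : ℕ) => x (k + 1))
      (Kernel.trajMeasure (X := fun _ : ℕ => S) π
        (fun n : ℕ => κ.comap (fun h : (j : ↥(Finset.Iic n)) → S => h ⟨n, Finset.mem_Iic.2 le_rfl⟩)
          (measurable_pi_apply _))) :=
  ergodic_shift_chain κ hπ fun B hB hout hin =>
    ae_invariant_trivial_of_minorized κ hε hmin B hB hout hin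

omit [IsMarkovKernel κ] in
/-- **Measure form of the minorisation**: if one non-zero finite measure `m` lies below every row
of the kernel, `m ≤ κ(z, ·)` for all `z`, every almost invariant `B` has `π B ∈ {0, 1}` (take
`m = ε ν` to recover the previous statement; this form is the one that multiplies across
independent chains). -/
theorem ae_invariant_trivial_of_measure_le [IsProbabilityMeasure π] {m : Measure S}
    [IsFiniteMeasure m] (hm0 : m univ ≠ 0) (hmin : ∀ z, m ≤ κ z) (B : Set S) (hB : MeasurableSet B)
    (hout : ∀ᵐ z ∂π, z ∈ B → κ z Bᶜ = 0) (hin : ∀ᵐ z ∂π, z ∉ B → κ z B = 0) :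
    π B = 0 ∨ π B = 1 := by
  by_cases hB0 : π B = 0
  · exact Or.inl hB0
  by_cases hBc : π Bᶜ = 0
  · exact Or.inr ((prob_compl_eq_zero_iff hB).1 hBc)
  exfalso
  have hin' : ∀ᵐ z ∂π, z ∈ Bᶜ → κ z B = 0 := hin
  obtain ⟨z, -, hz⟩ := exists_of_ae_imp hin' hBc
  obtain ⟨w, -, hw⟩ := exists_of_ae_imp hout hB0
  have h1 : m B = 0 := le_antisymm (((Measure.le_iff'.1 (hmin z)) B).trans hz.le) bot_le
  have h2 : m Bᶜ = 0 := le_antisymm (((Measure.le_iff'.1 (hmin w)) Bᶜ).trans hw.le) bot_le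
  have huniv : m univ = 0 := by
    rw [← Set.union_compl_self B, measure_union disjoint_compl_right hB.compl, h1, h2, add_zero]
  exact hm0 huniv

/-- **A stationary Markov chain minorised by a non-zero finite measure is ergodic.** -/
theorem ergodic_shift_chain_of_measure_le [IsProbabilityMeasure π] (hπ : Kernel.Invariant κ π)
    {m : Measure S} [IsFiniteMeasure m] (hm0 : m univ ≠ 0) (hmin : ∀ z, m ≤ κ z) :
    Ergodic (fun (x : ℕ → S) (k : ℕ) => x (k + 1))
      (Kernel.trajMeasure (X := fun _ : ℕ => S) π
        (fun n : ℕ => κ.comap (fun h : (j : ↥(Finset.Iic n)) → S => h ⟨n, Finset.mem_Iic.2 le_rfl⟩)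
          (measurable_pi_apply _))) :=
  ergodic_shift_chain κ hπ fun B hB hout hin =>
    ae_invariant_trivial_of_measure_le κ hm0 hmin B hB hout hin

/-! ## The engine's restart chain under a Doeblin level sampler -/

section Restart

variable {Ω E : Type*} [MeasurableSpace Ω] [MeasurableSpace E]

/-- **A minorisation of the level sampler passes to the restart kernel**: if `ε ν ≤ K(z, ·)` for all
`z`, then `ε (κF ∘ₘ ν) ≤ ((κF ∘ₖ K).comap s)(x, ·)` for all records `x`. -/
theorem minorized_comp_comap (K : Kernel Ω Ω) [IsMarkovKernel K] (κF : Kernel Ω E)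
    [IsMarkovKernel κF] {s : E → Ω} (hs : Measurable s) {ε : ℝ≥0∞} {ν : Measure Ω}
    (hmin : ∀ z t, MeasurableSet t → ε * ν t ≤ K z t) (x : E) (t : Set E) (ht : MeasurableSet t) :
    ε * (ν.bind κF) t ≤ ((κF ∘ₖ K).comap s hs) x t := by
  have hle : ε • ν ≤ K (s x) := by
    refine Measure.le_iff.2 fun u hu => ?_
    rw [Measure.smul_apply, smul_eq_mul]
    exact hmin (s x) u hu
  rw [Kernel.comap_apply, Kernel.comp_apply' _ _ _ ht, Measure.bind_apply ht (Kernel.aemeasurable _)]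
  calc ε * ∫⁻ a, κF a t ∂ν = ∫⁻ a, κF a t ∂(ε • ν) := by rw [lintegral_smul_measure, smul_eq_mul]
    _ ≤ ∫⁻ b, κF b t ∂(K (s x)) := lintegral_mono' hle le_rfl

/-- Measure form: `m ≤ K(z, ·)` for all `z` gives `m ∘ κF ≤ ((κF ∘ₖ K).comap s)(x, ·)` for all
records `x` (and `(κF ∘ₘ m)(E) = m(Ω)`). -/
theorem measure_le_comp_comap (K : Kernel Ω Ω) [IsMarkovKernel K] (κF : Kernel Ω E)
    [IsMarkovKernel κF] {s : E → Ω} (hs : Measurable s) {m : Measure Ω} (hmin : ∀ z, m ≤ K z)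
    (x : E) : m.bind κF ≤ ((κF ∘ₖ K).comap s hs) x := by
  refine Measure.le_iff.2 fun t ht => ?_
  rw [Kernel.comap_apply, Kernel.comp_apply' _ _ _ ht, Measure.bind_apply ht (Kernel.aemeasurable _)]
  exact lintegral_mono' (hmin (s x)) le_rfl

omit [MeasurableSpace Ω] in
/-- The total mass of `κF ∘ₘ m` is that of `m`. -/
theorem bind_apply_univ_of_markov [MeasurableSpace Ω] (κF : Kernel Ω E) [IsMarkovKernel κF]
    (m : Measure Ω) : m.bind κF univ = m univ := by
  rw [Measure.bind_apply MeasurableSet.univ (Kernel.aemeasurable _)]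
  simp

end Restart

namespace CrooksPair

variable {Ω E : Type*} [MeasurableSpace Ω] [MeasurableSpace E]
variable {ν₀ ν₁ : Measure Ω} {κF κR : Kernel Ω E} {s e : E → Ω} {W : E → ℝ}

/-- **The engine's equilibrium restart chain is ERGODIC under a Doeblin level sampler**: for a
Crooks pair, a `ν₀`-invariant level sampler `K` with `ε ν ≤ K(z, ·)` (`ε ≠ 0`, `ν` a probability
law), the restart chain of forward records started in `P_F` is ergodic for the shift. -/
theorem ergodic_restartChain_of_minorized (K : Kernel Ω Ω) [IsMarkovKernel K] [IsFiniteMeasure ν₀]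
    [IsMarkovKernel κF] (h0 : ν₀ univ ≠ 0) (hK : Kernel.Invariant K ν₀)
    (h : CrooksPair ν₀ ν₁ κF κR s e W) {ε : ℝ≥0∞} (hε : ε ≠ 0) {ν : Measure Ω}
    [IsProbabilityMeasure ν] (hmin : ∀ z t, MeasurableSet t → ε * ν t ≤ K z t) :
    haveI := isProbabilityMeasure_fwdPathLaw ν₀ h0 κF
    Ergodic (fun (x : ℕ → E) (k : ℕ) => x (k + 1))
      (Kernel.trajMeasure (X := fun _ : ℕ => E) (fwdPathLaw ν₀ κF)
        (fun n : ℕ => ((κF ∘ₖ K).comap s h.measurable_s).comap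
          (fun hh : (j : ↥(Finset.Iic n)) → E => hh ⟨n, Finset.mem_Iic.2 le_rfl⟩)
          (measurable_pi_apply _))) := by
  haveI := isProbabilityMeasure_fwdPathLaw ν₀ h0 κF
  haveI : IsProbabilityMeasure (ν.bind κF) := inferInstance
  exact ergodic_shift_chain_of_minorized _ (h.invariant_restartKernel K hK) hε (ν := ν.bind κF)
    (minorized_comp_comap K κF h.measurable_s hmin)

/-- **`ΔF̂_n → ΔF` ALMOST SURELY ALONG THE RESTART CHAIN, for every Doeblin-minorised level
sampler** — the correlated-starts strong consistency of the engine's Jarzynski estimate with no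
independence hypothesis and no ergodicity hypothesis left. -/
theorem tendsto_jarzynskiEstimate_ae_restartChain_of_minorized (K : Kernel Ω Ω) [IsMarkovKernel K]
    [IsFiniteMeasure ν₀] [IsFiniteMeasure ν₁] [IsMarkovKernel κF] [IsMarkovKernel κR]
    (h0 : ν₀ univ ≠ 0) (hK : Kernel.Invariant K ν₀) (h : CrooksPair ν₀ ν₁ κF κR s e W) {ΔF : ℝ}
    (hΔF : Real.exp (-ΔF) = ((ν₀ univ)⁻¹ * ν₁ univ).toReal) {ε : ℝ≥0∞} (hε : ε ≠ 0)
    {ν : Measure Ω} [IsProbabilityMeasure ν] (hmin : ∀ z t, MeasurableSet t → ε * ν t ≤ K z t) :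
    haveI := isProbabilityMeasure_fwdPathLaw ν₀ h0 κF
    ∀ᵐ x ∂(Kernel.trajMeasure (X := fun _ : ℕ => E) (fwdPathLaw ν₀ κF)
        (fun n : ℕ => ((κF ∘ₖ K).comap s h.measurable_s).comap
          (fun hh : (j : ↥(Finset.Iic n)) → E => hh ⟨n, Finset.mem_Iic.2 le_rfl⟩)
          (measurable_pi_apply _))),
      Tendsto (fun n : ℕ => jarzynskiEstimate (fun ε => Real.exp (-W ε)) (fun i : Fin n => x i))
        atTop (𝓝 ΔF) :=
  h.tendsto_jarzynskiEstimate_ae_restartChain K h0 hK hΔF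
    (h.ergodic_restartChain_of_minorized K h0 hK hε hmin)

end CrooksPair

end Summit.Ventures.LatticeQCDFlow.Exactness.GeneralNCMC
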